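import Summits.Ventures.PercRepro.S1TriangleUnionSix
import Summits.Ventures.PercRepro.S1ChainCoNullCellsTP

/-!
# PercRepro — THE UNION OF THE TRIANGLES AT ANY NULLITY (p2, gen 26; SUBCLAIM-S1 §6.10)

The structure behind the cell `(10, 7)` (S1TriangleUnionSix), freed of its numbers: on a coloop-free `e`-free
core of nullity `d` with more than `cq3 (d − 2)` triangles, the union `S₀` of the triangles has nullity `d − 1` or
`d`; nullity `d` means `S₀ = E` (every point on a triangle), and at nullity `d − 1` every four-circuit lies inside
`S₀` or contains `E ∖ S₀`. This is where the cap (P9,10) of S1CellNineTenCaps starts: `d = 10`, `t ≥ 14 > cq3 8 = 13`.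

* **`exists_triangle_union_of_cq3_lt`** — the union, its nullity `ν ∈ {d − 1, d}`, and the two readings.
Axioms: standard.
-/

open scoped Matroid

namespace PercRepro

namespace S1

open Set

variable {α : Type}

open Classical in
/-- **THE UNION OF THE TRIANGLES AT ANY NULLITY**: on a coloop-free `e`-free core of nullity `d` with
`t > cq3 (d − 2)` triangles, the union `S` of the triangles is covered by its triangles, holds every triangle, has
nullity `ν` with `d − 1 ≤ ν ≤ d`; if `ν = d` then `S = E`, and if `ν = d − 1` (with `d ≥ 1`) then every four-circuit
lies inside `S` or contains `E ∖ S`. -/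
theorem exists_triangle_union_of_cq3_lt (M : Matroid α) [M.Finite]
    (hfree : ∀ e ∈ M.E, ∃ A ⊆ M.E \ {e}, e ∉ M.closure A ∧ e ∉ M.closure ((M.E \ {e}) \ A))
    {d : ℕ} (hd : M.E.encard = M.eRank + (d : ℕ∞)) (hcol : M.coloops = ∅)
    (ht : TriangleCap.cq3 (d - 2) < {C : Set α | M.IsCircuit C ∧ C.ncard = 3}.ncard) :
    ∃ S ⊆ M.E, (∀ x ∈ S, ∃ C, M.IsCircuit C ∧ C.ncard = 3 ∧ C ⊆ S ∧ x ∈ C) ∧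
      (∀ C, M.IsCircuit C → C.ncard = 3 → C ⊆ S) ∧
      ∃ ν : ℕ, S.encard = M.eRk S + (ν : ℕ∞) ∧ d - 1 ≤ ν ∧ ν ≤ d ∧ (ν = d → S = M.E) ∧
        (ν + 1 = d → ∀ C, M.IsCircuit C → C.ncard = 4 → C ⊆ S ∨ M.E \ S ⊆ C) := by
  have hmem𝒯 : ∀ C, C ∈ (finite_triangles M).toFinset ↔ M.IsCircuit C ∧ C.ncard = 3 := fun C => by
    rw [Set.Finite.mem_toFinset]; rfl
  have h𝒯card : (finite_triangles M).toFinset.card = {C : Set α | M.IsCircuit C ∧ C.ncard = 3}.ncard :=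
    (Set.ncard_eq_toFinset_card _ (finite_triangles M)).symm
  obtain ⟨hSE, -, -, hsub, heq⟩ :=
    triangle_union_facts M ∅ (⋃ C ∈ (finite_triangles M).toFinset.filter (fun C => ∀ x ∈ (∅ : Set α), x ∉ C), C) rfl
  set S := ⋃ C ∈ (finite_triangles M).toFinset.filter (fun C => ∀ x ∈ (∅ : Set α), x ∉ C), C with hSdef
  have hvac : ∀ C : Set α, ∀ x ∈ (∅ : Set α), x ∉ C := fun C x hx => absurd hx (Set.notMem_empty x)
  have hsub' : ∀ C, M.IsCircuit C → C.ncard = 3 → C ⊆ S := fun C hC h3 => hsub C hC h3 (hvac C)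
  have hcov : ∀ x ∈ S, ∃ C, M.IsCircuit C ∧ C.ncard = 3 ∧ C ⊆ S ∧ x ∈ C := by
    intro x hx
    rw [hSdef, Set.mem_iUnion₂] at hx
    obtain ⟨C, hC, hxC⟩ := hx
    have hC3 := (hmem𝒯 C).1 (Finset.mem_filter.1 hC).1
    exact ⟨C, hC3.1, hC3.2, hsub' C hC3.1 hC3.2, hxC⟩
  -- the triangles inside `S` are all the triangles
  have hStri : {C : Set α | M.IsCircuit C ∧ C.ncard = 3 ∧ C ⊆ S}.ncard =
      {C : Set α | M.IsCircuit C ∧ C.ncard = 3}.ncard := by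
    rw [heq, Set.ncard_coe_finset, ← h𝒯card]
    congr 1
    apply Finset.filter_true_of_mem
    intro C _
    exact hvac C
  -- the nullity of `S`
  obtain ⟨ν, hν⟩ := exists_nullity M hSE
  have hSfin : S.Finite := M.ground_finite.subset hSE
  have hEν : M.E.encard = M.eRk M.E + (d : ℕ∞) := by rw [M.eRk_ground]; exact hd
  have hνd : ν ≤ d := nullity_le_of_subset M hSE Subset.rfl hν hEν
  have htri_le := ncard_triangles_subset_le_cq3 M hfree hSE hν
  rw [hStri] at htri_le
  have hνge : d - 1 ≤ ν := by
    by_contra hlt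
    have h1 : ν ≤ d - 2 := by omega
    have := cq3_mono h1
    omega
  refine ⟨S, hSE, hcov, hsub', ν, hν, hνge, hνd, ?_, ?_⟩
  · -- nullity `d` forces `S = E`
    intro hνeq
    by_contra hne
    have := nullity_add_one_le_of_ssubset_of_coloops_empty M hcol hd hSE hne (r := ν)
      (by rw [hSfin.cast_ncard_eq, hν])
    omega
  · -- nullity `d − 1`: the four-circuits
    intro hνeq C hC h4
    by_cases hCS : C ⊆ S
    · exact Or.inl hCS
    · right
      have hU := eRk_union_circuit_add_le M hSE hC hCS hν
      have hUE : S ∪ C = M.E := by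
        by_contra hUE
        have := nullity_add_one_le_of_ssubset_of_coloops_empty M hcol hd (union_subset hSE hC.subset_ground) hUE hU
        omega
      intro x hx
      have : x ∈ S ∪ C := hUE ▸ hx.1
      exact this.resolve_left hx.2

end S1

end PercRepro
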